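import Mathlib

/-!
# Route `FilamentSkeletonRss` · crux `TransverseReduction1AG` (stmt-NavierStokesRegularity-27853; A1L twin stmt-23297) · line
# `defect_column_gate_1AG/1AL` — the EXTERIOR FEED of the two-zone scheme for the azimuthal blocks of S2a-loc `WaistColumnGateLoc1A`:
# from the exterior sup bound `u⁴(a²+b²) ≤ Q` on `[u₁, ∞)` (`azimuthalBlock_exterior`, p671778) to the exterior Biot–Savart remainder
# `∫_{u₁}^U u(a²+b²) ≤ Q/(2u₁²)` that (Im)/(Re)-truncated (`…CoreTrunc`, `…CoreDissip`) carry — brick (b2) of the assembly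

Helper file (`--supports stmt-NavierStokesRegularity-27853 --as helper`; seat ns-filament-s2aloc-p1 g2; note ARCHITECTURE-B2B3-s2aloc-g2.md v3 §7).
Pure one-variable real analysis, no project imports.  HONEST FRAMING: an elementary lemma serving ONE family of blocks of ONE linear MODEL operator of
a hypothetical blow-up route (MODEL rung, negative side); nothing here bears on NS regularity.
-/

set_option linter.dupNamespace false

noncomputable section

namespace Summit.NavierStokesRegularity.NavierStokesRegularity.Theorems.DefectColumnGate

open scoped Topology
open Set Filter MeasureTheory intervalIntegral

/-- `∫_{u₁}^U v^{-3} dv = (u₁⁻² − U⁻²)/2 ≤ 1/(2u₁²)` for `0 < u₁ ≤ U`. -/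
theorem integral_inv_cube_le {u₁ U : ℝ} (hu₁ : 0 < u₁) (hu₁U : u₁ ≤ U) :
    ∫ v in u₁..U, 1 / v ^ 3 ≤ 1 / (2 * u₁ ^ 2) := by
  have hU : 0 < U := lt_of_lt_of_le hu₁ hu₁U
  have hderiv : ∀ v ∈ uIcc u₁ U, HasDerivAt (fun x : ℝ => -(1 / (2 * x ^ 2))) (1 / v ^ 3) v := by
    intro v hv
    rw [uIcc_of_le hu₁U] at hv
    have hv0 : v ≠ 0 := (lt_of_lt_of_le hu₁ hv.1).ne'
    have h1 : HasDerivAt (fun x : ℝ => x ^ 2) (2 * v) v := by simpa using (hasDerivAt_pow 2 v)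
    have h2 : HasDerivAt (fun x : ℝ => 2 * x ^ 2) (2 * (2 * v)) v := h1.const_mul 2
    have h3 : HasDerivAt (fun x : ℝ => (2 * x ^ 2)⁻¹) (-(2 * (2 * v)) / (2 * v ^ 2) ^ 2) v :=
      h2.inv (by positivity)
    have h4 := h3.neg
    refine h4.congr_deriv ?_ |>.congr_of_eventuallyEq ?_
    · field_simp
    · exact Filter.Eventually.of_forall (fun x => by simp [one_div])
  have hcont : ContinuousOn (fun v : ℝ => 1 / v ^ 3) (uIcc u₁ U) := by
    rw [uIcc_of_le hu₁U]
    exact continuousOn_const.div (continuousOn_id.pow 3) (fun v hv => pow_ne_zero 3 (lt_of_lt_of_le hu₁ hv.1).ne')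
  rw [integral_eq_sub_of_hasDerivAt hderiv (hcont.intervalIntegrable)]
  have : 0 < 1 / (2 * U ^ 2) := by positivity
  linarith

/-- **Exterior feed.**  If `a, b` are continuous on `[u₁, U]` (`0 < u₁ ≤ U`) and `v⁴(a² + b²)(v) ≤ Q` for all `v ∈ [u₁, U]`, then
`∫_{u₁}^U v(a² + b²) ≤ Q/(2u₁²)` — the exterior Biot–Savart remainder of the truncated core identities in terms of the exterior sup. -/
theorem exterior_feed_le {u₁ U Q : ℝ} {a b : ℝ → ℝ} (hu₁ : 0 < u₁) (hu₁U : u₁ ≤ U)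
    (ha : ContinuousOn a (Icc u₁ U)) (hb : ContinuousOn b (Icc u₁ U))
    (hQ : ∀ v ∈ Icc u₁ U, v ^ 4 * (a v ^ 2 + b v ^ 2) ≤ Q) :
    ∫ v in u₁..U, v * (a v ^ 2 + b v ^ 2) ≤ Q / (2 * u₁ ^ 2) := by
  have hQ0 : 0 ≤ Q := le_trans (by positivity) (hQ u₁ (left_mem_Icc.2 hu₁U))
  have hcont : ContinuousOn (fun v => v * (a v ^ 2 + b v ^ 2)) (Icc u₁ U) := continuousOn_id.mul ((ha.pow 2).add (hb.pow 2))
  have hcont3 : ContinuousOn (fun v : ℝ => Q * (1 / v ^ 3)) (Icc u₁ U) :=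
    continuousOn_const.mul (continuousOn_const.div (continuousOn_id.pow 3)
      (fun v hv => pow_ne_zero 3 (lt_of_lt_of_le hu₁ hv.1).ne'))
  have h1 : ∫ v in u₁..U, v * (a v ^ 2 + b v ^ 2) ≤ ∫ v in u₁..U, Q * (1 / v ^ 3) := by
    apply integral_mono_on hu₁U (hcont.intervalIntegrable_of_Icc hu₁U) (hcont3.intervalIntegrable_of_Icc hu₁U)
    intro v hv
    have hv0 : 0 < v := lt_of_lt_of_le hu₁ hv.1
    have h := hQ v hv
    rw [mul_one_div, le_div_iff₀ (by positivity)]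
    nlinarith [hv0]
  rw [intervalIntegral.integral_const_mul] at h1
  have h2 := mul_le_mul_of_nonneg_left (integral_inv_cube_le hu₁ hu₁U) hQ0
  have e : Q * (1 / (2 * u₁ ^ 2)) = Q / (2 * u₁ ^ 2) := by ring
  linarith

end Summit.NavierStokesRegularity.NavierStokesRegularity.Theorems.DefectColumnGate

end
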